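import Summits.Parity.GeneralizedHardyLittlewood.Theorems.GreenTaoLevelTwoGITwoCyclicInverseCauchySchwarz

/-!
# Route `GreenTaoLevelTwo`, crux `GITwo` (stmt-Parity-21275), line `birth`, stub `stub_cyclicInverse`:
# large trilinear form ⇒ correlation with a linear phase (GT08a arXiv Lemma 23)

Thirty-eighth helper file toward the XL stub `stub_cyclicInverse` (B. Green, T. Tao, *An inverse
theorem for the Gowers `U³(G)` norm*, arXiv:math/0503014, Thm. 68 = PEMS 51 (2008) Thm. 12.8).
arXiv Lemma 23 (§4, "`fgh`-lemma"), used in §9 Step 4 (block C13) to pass from a large trilinear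
average over Bohr sets to a large local `u²` norm: in sum form over `ℤ/Nℤ`, for finsets `B, B'`,
any `f` and weights `‖b₁‖ ≤ 1` on `B`, `‖b₂‖ ≤ 1`,
`‖Σ_{z∈B'} Σ_{x∈B} f(z) b₁(x) b₂(z+x)‖² ≤ #B · #(B'+B) · max_ξ ‖Σ_{z∈B'} f(z) e(zξ/N)‖²`
(the paper's bound has `#(B+B')²` in place of `#B · #(B'+B)`).  Complex Fourier analysis on `ℤ/Nℤ`
is done inline with Mathlib's `ZMod.stdAddChar` (unnormalised transform `Σ_x h(x) e(−xξ/N)`):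

* `sum_norm_sq_fourier_eq` — Parseval: `Σ_ξ ‖Σ_x h(x) e(−xξ)‖² = N Σ_x ‖h(x)‖²`;
* `fourier_sum_shift_mul` — transform of `x ↦ Σ_z F(z) β(x+z)` is `(Σ_z F(z)e(zξ))·(Σ_y β(y)e(−yξ))`;
* `sum_norm_sq_shift_mul_le` — `Σ_x ‖Σ_z F(z)β(x+z)‖² ≤ max_ξ‖Σ_z F(z)e(zξ)‖² · Σ_y ‖β(y)‖²`;
* `norm_trilinear_sq_le` — **arXiv Lemma 23** as displayed.

References: [GreenTao2008U3Inverse] arXiv:math/0503014, Lemma 23.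
-/

noncomputable section

namespace Summit.Parity.GeneralizedHardyLittlewood.GreenTaoLevelTwoGITwoCyclicInverse

open Finset ZMod
open scoped ComplexConjugate Pointwise

open Literature.NumberTheory.Sieve

variable {N : ℕ} [NeZero N]

/-- **Parseval on `ℤ/Nℤ`** (unnormalised): `Σ_ξ ‖Σ_x h(x) e(−xξ/N)‖² = N · Σ_x ‖h(x)‖²`.
[folklore] -/
theorem sum_norm_sq_fourier_eq (h : ZMod N → ℂ) :
    ∑ ξ : ZMod N, ‖∑ x : ZMod N, h x * stdAddChar (-(x * ξ))‖ ^ 2 =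
      N * ∑ x : ZMod N, ‖h x‖ ^ 2 := by
  -- work in `ℂ`
  have key : ((∑ ξ : ZMod N, ‖∑ x : ZMod N, h x * stdAddChar (-(x * ξ))‖ ^ 2 : ℝ) : ℂ) =
      ((N * ∑ x : ZMod N, ‖h x‖ ^ 2 : ℝ) : ℂ) := by
    rw [ofReal_sum_norm_sum_sq]
    -- `Σ_ξ Σ_{x'} Σ_x h x' e(−x'ξ) conj(h x e(−xξ)) = Σ_{x',x} h x' conj(h x) Σ_ξ e((x − x')ξ)`
    have h1 : ∀ ξ x' x : ZMod N, h x' * (stdAddChar (-(x' * ξ)) : ℂ) *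
        conj (h x * stdAddChar (-(x * ξ))) = h x' * conj (h x) * stdAddChar ((x - x') * ξ) := by
      intro ξ x' x
      rw [map_mul, conj_stdAddChar, neg_neg, mul_mul_mul_comm, ← AddChar.map_add_eq_mul]
      congr 2; ring
    simp_rw [h1]
    rw [Finset.sum_comm]
    simp_rw [Finset.sum_comm (s := (univ : Finset (ZMod N))) (t := (univ : Finset (ZMod N)))
      (f := fun ξ x => h _ * conj (h x) * (stdAddChar ((x - _) * ξ) : ℂ))]
    simp_rw [← Finset.mul_sum, sum_stdAddChar_mul_eq, sub_eq_zero]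
    push_cast
    rw [Finset.mul_sum]
    refine sum_congr rfl fun x' _ => ?_
    simp_rw [mul_ite, mul_zero]
    rw [Finset.sum_ite_eq' univ x', if_pos (mem_univ _), ← Complex.ofReal_pow,
      ofReal_norm_sq_eq_mul_conj]
    ring
  exact_mod_cast key

/-- The transform of `x ↦ Σ_z F(z) β(x+z)` factors: `Σ_x (Σ_z F(z)β(x+z)) e(−xξ) =
(Σ_z F(z) e(zξ)) · (Σ_y β(y) e(−yξ))`. [folklore] -/
theorem fourier_sum_shift_mul (F β : ZMod N → ℂ) (B' : Finset (ZMod N)) (ξ : ZMod N) :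
    ∑ x : ZMod N, (∑ z ∈ B', F z * β (x + z)) * stdAddChar (-(x * ξ)) =
      (∑ z ∈ B', F z * stdAddChar (z * ξ)) * ∑ y : ZMod N, β y * stdAddChar (-(y * ξ)) := by
  rw [Finset.sum_mul]
  simp_rw [Finset.sum_mul]
  rw [Finset.sum_comm]
  refine sum_congr rfl fun z _ => ?_
  rw [Finset.mul_sum]
  -- reindex `x ↦ x + z`
  rw [← Equiv.sum_comp (Equiv.addRight z) (fun y => F z * (stdAddChar (z * ξ) : ℂ) *
    (β y * stdAddChar (-(y * ξ))))]
  refine sum_congr rfl fun x _ => ?_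
  simp only [Equiv.coe_addRight]
  have hψ : (stdAddChar (-(x * ξ)) : ℂ) = stdAddChar (z * ξ) * stdAddChar (-((x + z) * ξ)) := by
    rw [← AddChar.map_add_eq_mul]; congr 1; ring
  rw [hψ]; ring

/-- `Σ_x ‖Σ_{z∈B'} F(z) β(x+z)‖² ≤ ‖Σ_{z∈B'} F(z) e(zξ₀)‖² · Σ_y ‖β(y)‖²` for a maximising frequency
`ξ₀`. [cite: GreenTao2008U3Inverse, Lemma 23 (proof)] -/
theorem sum_norm_sq_shift_mul_le (F β : ZMod N → ℂ) (B' : Finset (ZMod N)) :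
    ∃ ξ₀ : ZMod N, ∑ x : ZMod N, ‖∑ z ∈ B', F z * β (x + z)‖ ^ 2 ≤
      ‖∑ z ∈ B', F z * stdAddChar (z * ξ₀)‖ ^ 2 * ∑ y : ZMod N, ‖β y‖ ^ 2 := by
  have hNpos : (0 : ℝ) < N := by exact_mod_cast Nat.pos_of_ne_zero (NeZero.ne N)
  obtain ⟨ξ₀, -, hmax⟩ := exists_max_image (univ : Finset (ZMod N))
    (fun ξ => ‖∑ z ∈ B', F z * (stdAddChar (z * ξ) : ℂ)‖) univ_nonempty
  refine ⟨ξ₀, ?_⟩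
  set A : ZMod N → ℂ := fun x => ∑ z ∈ B', F z * β (x + z) with hA
  -- Parseval for `A` and for `β`
  have hPA := sum_norm_sq_fourier_eq A
  have hPβ := sum_norm_sq_fourier_eq β
  -- the transform of `A`
  have hAhat : ∀ ξ, ‖∑ x : ZMod N, A x * stdAddChar (-(x * ξ))‖ ^ 2 ≤
      ‖∑ z ∈ B', F z * stdAddChar (z * ξ₀)‖ ^ 2 * ‖∑ y : ZMod N, β y * stdAddChar (-(y * ξ))‖ ^ 2 := by
    intro ξ
    rw [hA]
    simp only
    rw [fourier_sum_shift_mul, norm_mul, mul_pow]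
    exact mul_le_mul_of_nonneg_right
      (pow_le_pow_left₀ (norm_nonneg _) (hmax ξ (mem_univ _)) 2) (sq_nonneg _)
  have hsum : (N : ℝ) * ∑ x : ZMod N, ‖A x‖ ^ 2 ≤
      ‖∑ z ∈ B', F z * stdAddChar (z * ξ₀)‖ ^ 2 * (N * ∑ y : ZMod N, ‖β y‖ ^ 2) := by
    rw [← hPA, ← hPβ, Finset.mul_sum]
    exact sum_le_sum fun ξ _ => hAhat ξ
  have h2 : (N : ℝ) * ∑ x : ZMod N, ‖A x‖ ^ 2 ≤
      N * (‖∑ z ∈ B', F z * stdAddChar (z * ξ₀)‖ ^ 2 * ∑ y : ZMod N, ‖β y‖ ^ 2) := by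
    calc _ ≤ _ := hsum
      _ = _ := by ring
  exact le_of_mul_le_mul_left h2 hNpos

/-- **GT08a arXiv Lemma 23 (large trilinear form ⇒ correlation with a linear phase), sum form.**
For finsets `B, B' ⊆ ℤ/Nℤ`, any `f : ℤ/Nℤ → ℂ` and weights `‖b₁‖ ≤ 1` on `B`, `‖b₂‖ ≤ 1`, there is a
frequency `ξ₀` with
`‖Σ_{z∈B'} Σ_{x∈B} f(z) b₁(x) b₂(z+x)‖² ≤ #B · #(B'+B) · ‖Σ_{z∈B'} f(z) e(zξ₀/N)‖²`.
[cite: GreenTao2008U3Inverse, Lemma 23] -/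
theorem norm_trilinear_sq_le (B B' : Finset (ZMod N)) (f b₁ b₂ : ZMod N → ℂ)
    (hb₁ : ∀ x ∈ B, ‖b₁ x‖ ≤ 1) (hb₂ : ∀ y, ‖b₂ y‖ ≤ 1) :
    ∃ ξ₀ : ZMod N, ‖∑ z ∈ B', ∑ x ∈ B, f z * b₁ x * b₂ (z + x)‖ ^ 2 ≤
      #B * #(B' + B) * ‖∑ z ∈ B', f z * stdAddChar (z * ξ₀)‖ ^ 2 := by
  classical
  -- restrict `b₂` to `B' + B`
  set β : ZMod N → ℂ := fun y => if y ∈ B' + B then b₂ y else 0 with hβ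
  obtain ⟨ξ₀, hξ₀⟩ := sum_norm_sq_shift_mul_le f β B'
  refine ⟨ξ₀, ?_⟩
  -- rewrite the trilinear form as `Σ_{x∈B} b₁(x) A(x)` with `A(x) = Σ_{z∈B'} f(z) β(x+z)`
  have hT : ∑ z ∈ B', ∑ x ∈ B, f z * b₁ x * b₂ (z + x) =
      ∑ x ∈ B, b₁ x * ∑ z ∈ B', f z * β (x + z) := by
    rw [Finset.sum_comm]
    refine sum_congr rfl fun x hx => ?_
    rw [Finset.mul_sum]
    refine sum_congr rfl fun z hz => ?_
    have hmem : x + z ∈ B' + B := Finset.mem_add.mpr ⟨z, hz, x, hx, add_comm z x⟩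
    rw [hβ]
    simp only
    rw [if_pos hmem, add_comm z x]
    ring
  rw [hT]
  -- Cauchy–Schwarz in `x`
  have hCS := norm_sum_mul_sum_sq_le B B' (fun x z => f z * β (x + z)) b₁ hb₁
  -- `Σ_{x∈B} ‖A x‖² ≤ Σ_x ‖A x‖² ≤ max · Σ_y ‖β y‖² ≤ max · #(B'+B)`
  have h1 : ∑ x ∈ B, ‖∑ z ∈ B', f z * β (x + z)‖ ^ 2 ≤
      ∑ x : ZMod N, ‖∑ z ∈ B', f z * β (x + z)‖ ^ 2 :=
    sum_le_sum_of_subset_of_nonneg (subset_univ _) fun _ _ _ => sq_nonneg _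
  have h2 : ∑ y : ZMod N, ‖β y‖ ^ 2 ≤ #(B' + B) := by
    have : ∀ y : ZMod N, ‖β y‖ ^ 2 ≤ if y ∈ B' + B then (1 : ℝ) else 0 := by
      intro y
      rw [hβ]
      simp only
      split_ifs with hy
      · have := hb₂ y
        have h0 := norm_nonneg (b₂ y)
        nlinarith
      · simp
    refine (sum_le_sum fun y _ => this y).trans (le_of_eq ?_)
    rw [Finset.sum_boole, Finset.filter_univ_mem]
  have h3 := mul_le_mul_of_nonneg_left h2 (sq_nonneg ‖∑ z ∈ B', f z * (stdAddChar (z * ξ₀) : ℂ)‖)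
  calc ‖∑ x ∈ B, b₁ x * ∑ z ∈ B', f z * β (x + z)‖ ^ 2
      ≤ #B * ∑ x ∈ B, ‖∑ z ∈ B', f z * β (x + z)‖ ^ 2 := hCS
    _ ≤ #B * (‖∑ z ∈ B', f z * stdAddChar (z * ξ₀)‖ ^ 2 * #(B' + B)) :=
        mul_le_mul_of_nonneg_left ((h1.trans hξ₀).trans h3) (Nat.cast_nonneg _)
    _ = #B * #(B' + B) * ‖∑ z ∈ B', f z * stdAddChar (z * ξ₀)‖ ^ 2 := by ring

end Summit.Parity.GeneralizedHardyLittlewood.GreenTaoLevelTwoGITwoCyclicInverse
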